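import Literature.AnabelianGeometry.SemiGraphs.IwahoriMetabelianLeaves
import HarnessLib

/-!
# The metabelian leaves `ℤ_p ⋊ ⟨1 + p^{n+1}⟩‾` are slim («RAYLESS-STAR·CIV-NEG», brick S2, part 2)

Mochizuki, *Semi-graphs of anabelioids*, Publ. RIMS **42** (2006), Def. 2.4 (ii) p. 25 ("verticially slim":
every `Π_v` is slim, i.e. every open subgroup has trivial centraliser) [cite: MochizukiSemiAnbd2006, Def 2.4(ii) p.25].

PROOF-ONLY companion of `IwahoriMetabelianLeaves.lean` (abc-iut cell, layer L3, row «RAYLESS-STAR·CIV-NEG», seat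
abc-iut-L3-t8 gen 6): the leaf groups `Iw.Leaf n = ℤ_p ⋊ C_n ≤ Iw p` of the rayless counter-carrier `𝒢⋆` are
SLIM — an open subgroup of `Leaf n` contains a translation `(p^k, 0)` and a non-trivial torus element `(0, s₀)`,
and an element of `Iw p` commuting with both is trivial (the computation of abc-iut-w5-d236's
`Iw.centralizer_eq_bot_of_isOpen`, run inside the closed subgroup).  Pure group theory; 0 definitions; no side
taken on [IUTchIII] Cor 3.12.
-/

noncomputable section

open Topology Multiplicative

namespace Literature.AnabelianGeometry.SemiGraphs

open IwahoriWitness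

variable {p : ℕ} [hp : Fact p.Prime]

namespace Iw

/-! ## 4. Slimness of the leaves -/

/-- The translations `(p^k, 0)` lie in every leaf and tend to `1`; hence an open subgroup of `Leaf n`
contains one of them. [cite: MochizukiSemiAnbd2006, Def 2.4(ii) p.25] -/
theorem exists_transl_pow_mem_of_isOpen {n : ℕ} (H : Subgroup (Leaf (p := p) n))
    (hH : IsOpen (H : Set (Leaf (p := p) n))) :
    ∃ k : ℕ, ∃ hk : (⟨(p : ℤ_[p]) ^ k, 0⟩ : Iw p) ∈ Leaf (p := p) n, (⟨_, hk⟩ : Leaf (p := p) n) ∈ H := by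
  have h1 : (H : Set (Leaf (p := p) n)) ∈ 𝓝 (1 : Leaf (p := p) n) := hH.mem_nhds H.one_mem
  have hmemL : ∀ k : ℕ, (⟨(p : ℤ_[p]) ^ k, 0⟩ : Iw p) ∈ Leaf (p := p) n := fun k => by
    rw [mem_leaf_iff]; exact (IwU.C n).one_mem
  let f : ℕ → Leaf (p := p) n := fun k => ⟨⟨(p : ℤ_[p]) ^ k, 0⟩, hmemL k⟩
  have hpow : Filter.Tendsto (fun k : ℕ => (p : ℤ_[p]) ^ k) Filter.atTop (𝓝 0) :=
    tendsto_pow_atTop_nhds_zero_of_norm_lt_one (by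
      rw [PadicInt.norm_p]; exact inv_lt_one_of_one_lt₀ (by exact_mod_cast hp.out.one_lt))
  have hf : Filter.Tendsto f Filter.atTop (𝓝 1) := by
    rw [tendsto_subtype_rng]
    have hc : Continuous fun q : ℤ_[p] => (⟨q, 0⟩ : Iw p) :=
      (continuous_mk_iff (p := p)).2 ⟨continuous_id, continuous_const⟩
    have h0 : (⟨(0 : ℤ_[p]), 0⟩ : Iw p) = ((1 : Leaf (p := p) n) : Iw p) := rfl
    rw [← h0]
    exact (hc.tendsto 0).comp hpow
  obtain ⟨k, hk⟩ := Filter.tendsto_atTop'.1 hf _ h1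
  exact ⟨k, hmemL k, hk k le_rfl⟩

/-- An open subgroup of `Leaf n` contains a NON-TRIVIAL element of `B_n` (the elements `u_n^{p^k} ↦ (0, ·)`
tend to `1` along the injective leaf gluing). [cite: MochizukiSemiAnbd2006, Def 2.4(ii) p.25] -/
theorem exists_torus_mem_of_isOpen {n : ℕ} (H : Subgroup (Leaf (p := p) n))
    (hH : IsOpen (H : Set (Leaf (p := p) n))) :
    ∃ z : Leaf (p := p) n, z ∈ H ∧ (z : Iw p).a = 0 ∧ (z : Iw p).s ≠ 0 := by
  have h1 : (H : Set (Leaf (p := p) n)) ∈ 𝓝 (1 : Leaf (p := p) n) := hH.mem_nhds H.one_mem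
  have hpow : Filter.Tendsto (fun k : ℕ => (p : ℤ_[p]) ^ k) Filter.atTop (𝓝 0) :=
    tendsto_pow_atTop_nhds_zero_of_norm_lt_one (by
      rw [PadicInt.norm_p]; exact inv_lt_one_of_one_lt₀ (by exact_mod_cast hp.out.one_lt))
  let g : ℕ → Leaf (p := p) n := fun k => lowHom n (ofAdd ((p : ℤ_[p]) ^ k))
  have hg : Filter.Tendsto g Filter.atTop (𝓝 1) := by
    have hc : Continuous fun q : ℤ_[p] => lowHom (p := p) n (ofAdd q) :=
      (lowHom (p := p) n).continuous.comp continuous_ofAdd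
    have h0 : lowHom (p := p) n (ofAdd (0 : ℤ_[p])) = 1 := by rw [ofAdd_zero, map_one]
    rw [← h0]
    exact (hc.tendsto 0).comp hpow
  obtain ⟨k, hk⟩ := Filter.tendsto_atTop'.1 hg _ h1
  refine ⟨g k, hk k le_rfl, by simp [g], fun hs => ?_⟩
  -- `(g k).s = 0` would make `zpowGen n (p^k) = 1`, contradicting injectivity
  have h1' : IwU.zpowGen (p := p) n (ofAdd ((p : ℤ_[p]) ^ k)) = 1 := by
    ext; simpa [g] using hs
  have h2 : ofAdd ((p : ℤ_[p]) ^ k) = (1 : Multiplicative ℤ_[p]) :=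
    IwU.zpowGen_injective n (h1'.trans (map_one _).symm)
  have h3 : ((p : ℤ_[p]) ^ k) = 0 := by simpa using congrArg toAdd h2
  exact pow_ne_zero _ p_ne_zero h3

/-- **The leaves are slim**: the centraliser of every open subgroup of `Leaf n` is trivial (an element
commuting with a translation `(p^k, 0)` has `s = 0`; commuting with a non-trivial torus element forces
`a = 0`). [cite: MochizukiSemiAnbd2006, Def 2.4(ii) p.25] -/
theorem isSlimGroup_leaf (n : ℕ) :
    Literature.AlgebraicGeometry.Frobenioids.IsSlimGroup (Leaf (p := p) n) := by
  refine ⟨fun H hH => ?_⟩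
  obtain ⟨k, hkL, hkH⟩ := exists_transl_pow_mem_of_isOpen H hH
  obtain ⟨z, hzH, hza, hzs⟩ := exists_torus_mem_of_isOpen H hH
  rw [eq_bot_iff]
  intro c hc
  rw [Subgroup.mem_centralizer_iff] at hc
  rw [Subgroup.mem_bot]
  have hpk : ((p : ℤ_[p]) ^ k) ≠ 0 := pow_ne_zero _ p_ne_zero
  -- commuting with `(p^k, 0)` forces `c.s = 0`
  have e1 := congrArg (fun w : Leaf (p := p) n => (w : Iw p)) (hc _ hkH)
  have hs : (c : Iw p).s = 0 := by
    have ha := congrArg Iw.a e1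
    simp only [Subgroup.coe_mul, mul_a, w, mul_zero, add_zero] at ha
    have : (p : ℤ_[p]) * (c : Iw p).s * (p : ℤ_[p]) ^ k = 0 := by linear_combination -ha
    rcases mul_eq_zero.1 this with h | h
    · rcases mul_eq_zero.1 h with h' | h'
      · exact absurd h' p_ne_zero
      · exact h'
    · exact absurd h hpk
  -- commuting with `z = (0, s₀)`, `s₀ ≠ 0`, forces `c.a = 0`
  have e2 := congrArg (fun w : Leaf (p := p) n => (w : Iw p)) (hc _ hzH)
  have ha : (c : Iw p).a = 0 := by
    have ha' := congrArg Iw.a e2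
    simp only [Subgroup.coe_mul, mul_a, w, hs, hza, mul_zero, add_zero, zero_add] at ha'
    have : (p : ℤ_[p]) * (z : Iw p).s * (c : Iw p).a = 0 := by linear_combination ha'
    rcases mul_eq_zero.1 this with h | h
    · rcases mul_eq_zero.1 h with h' | h'
      · exact absurd h' p_ne_zero
      · exact absurd h' hzs
    · exact h
  ext1
  ext
  · rw [ha]; rfl
  · rw [hs]; rfl

end Iw

end Literature.AnabelianGeometry.SemiGraphs

end
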